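import Summits.BirchSwinnertonDyer.Rank1Residual.X11b.AnticyclotomicSelmerDual
import Literature.NumberTheory.EllipticCurves.IwasawaNakayamaProofs
import Literature.NumberTheory.EllipticCurves.IwasawaEulerCharRankZeroProofs
import HarnessLib

/-!
# X11b, route R1 — `X_ac^Σ(E[p^∞])` and `Sel_𝔭^Σ(K_∞, E[p^∞])` form a Pontryagin DUAL PAIR:
# Nakayama's lemma and Greenberg's Lemma 4.2 for the constructed `Λ`-module

HONEST FRAMING (cell `b2b-bsdres`, run/shared/lean/b2b/bsd-rank1-residual/, verbatim in every
file): the goal of the cell is to DELETE the COMBINATION-SHAPED residual classes of the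
Birch–Swinnerton-Dyer formula for ALL analytic-rank `≤ 1` elliptic curves over `ℚ` — "full BSD
formula for every rank `≤ 1` curve in class `C`" assembled STRICTLY from published theorems — so
that the rank-`≤ 1` remainder becomes exactly the CONSTRUCTION-SHAPED classes, which are TYPED
(missing-input `Prop`s), NOT attempted. This is not "finishing BSD". Sub-cell
`b2b-bsdres-multr1-p1` (X11b, route R1 = Castella 2018 Thm. A re-proved along the author's
erratum); a RESEARCH ROUTE; no claim beyond the stated class; X11b stays CONSTRUCTION-SHAPED;
nothing here changes a label; no named fact is minted (theorems only; no `sorry`).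

## Content (sequel of `AnticyclotomicSelmerDual.lean`)

Castella, Camb. J. Math. 6 (2018) §2.1 (arXiv:1704.06608 p. 5): "Set
`X_ac^Σ(E[p^∞]) := Hom_{ℤ_p}(Sel_𝔭^Σ(K_∞, E[p^∞]), ℚ_p/ℤ_p)`, which is easily shown to be a finitely
generated `Λ`-module". The tree proves Greenberg's version of "easily shown" (LNM 1716, §1 p. 60:
"`X/𝔪X` is finite … By a version of Nakayama's Lemma (valid for profinite `Λ`-modules `X`) …") in the
untopologised axiomatic setting `IwasawaDual.IsDualPair p ψ toDual` (`IwasawaNakayamaProofs`: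
`toDual : X ≃ Hom(S, ℚ/ℤ)`, `T ↔ ψ`, constants through `ℤ_p → ℤ/p^k`, `(p, ψ)` locally nilpotent),
and Greenberg's Lemma 4.2 (LNM 1716 §4, `f(0) ∼ #S^Γ/#S_Γ`) in the same setting
(`IwasawaEulerCharRankZeroProofs`). This file records that the CONSTRUCTED module
`X_ac^Σ(E[p^∞]) = XAc W p κ 𝔭 S γ` of `AnticyclotomicSelmerDual.lean` and Castella's Selmer group
`Sel_𝔭^Σ(K_∞, E[p^∞]) = selmerAc W p κ 𝔭 S` ARE such a dual pair, for `ψ = conj_γ − 1` and `toDual`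
the identity (the module was built as `Hom(Sel, ℚ/ℤ)` with exactly this `Λ`-action), and draws the
two generic consequences:

* `XAc.isDualPair` — the dual pair, `toDual = AddMonoidHom.id` (`X_smul_apply`, `C_smul_apply`,
  `isLocNil_conjSelmerAc_sub_one`);
* **`XAc.module_finite_of_finite`** — NAKAYAMA: if `Sel_𝔭^Σ(K_∞, E[p^∞])[𝔪] = {s | p s = 0,
  conj_γ s = s}` is finite then `X_ac^Σ(E[p^∞])` is a finitely generated `Λ`-module (the finiteness
  is PROVED for finite `Σ` in the companion `AnticyclotomicModuleFinite.lean`);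
* `XAc.natCard_coinvariants_eq`, `XAc.natCard_invariants_eq` — `#(X_ac/T X_ac) = #Sel^{γ}`,
  `#X_ac[T] = #Sel_{γ}` (Pontryagin duality, tree);
* **`XAc.eulerChar`** — GREENBERG'S LEMMA 4.2 for `X_ac^Σ`: if `X_ac^Σ` is finitely generated and
  `Λ`-torsion with `Ch_Λ(X_ac^Σ) = (f)` and `Sel^{γ} = (Sel_𝔭^Σ)^{conj_γ}` is finite, then `Sel_{γ}` is
  finite, `f(0) ≠ 0` and `f(0) · #Sel_γ = u · #Sel^γ` for a unit `u ∈ ℤ_pˣ` — so the number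
  "`ord_p f_ac^Σ(0)`" of Cas18 Thm. 2.3 / erratum Thm. 1.1 is `log_p #Sel^γ − log_p #Sel_γ`, a quantity
  that only sees the SETS `Sel^γ` and `(conj_γ − 1) Sel` (used in `AnticyclotomicGeneratorChange.lean`
  for the independence of `XAc.HasCharValuationAt` from the topological generator `γ`).

Nothing is asserted about cotorsion, control or the main conjecture.

References: [Castella2018] §2.1–2.2, Thm. 2.3 (arXiv:1704.06608 p. 5); [GreenbergLNM1716] §1 p. 60,
§4 Lemma 4.2 (p. 102); [Lang1990] Ch. 5 §1 (Nakayama's lemma, p. 94).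
-/

noncomputable section

open scoped Classical

open NumberField IsDedekindDomain Field
open Literature.NumberTheory.EllipticCurves Literature.NumberTheory.EllipticCurves.GreenbergSelmer
open Literature.NumberTheory.GaloisRepresentations

universe u

namespace Summit.BirchSwinnertonDyer.Rank1Residual.X11b.AcSelmer

variable {K : Type u} [Field K] [NumberField K]

namespace XAc

variable (W : WeierstrassCurve K) (p : ℕ) [Fact p.Prime]
  (κ : ZpExtension K p) (𝔭 : HeightOneSpectrum (𝓞 K)) (S : Set (HeightOneSpectrum (𝓞 K)))
  (γ : absoluteGaloisGroup K) [hγ : Fact (κ.IsTopGenerator γ)]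

/-- **`(X_ac^Σ(E[p^∞]), Sel_𝔭^Σ(K_∞, E[p^∞]))` is a Pontryagin dual pair** in the sense of the tree's
`IwasawaDual.IsDualPair` for `ψ = conj_γ − 1`: `toDual` bijective, `T` acts as `ψ`
(`X_smul_apply`), constants act through `ℤ_p → ℤ/p^k` (`C_smul_apply`), and `(p, ψ)` is locally
nilpotent on `Sel` (`isLocNil_conjSelmerAc_sub_one`); here `toDual` is the IDENTITY
`AddMonoidHom.id (XAc …)` — the module `XAc W p κ 𝔭 S γ` was constructed as this group of
characters (`AnticyclotomicSelmerDual.lean`). Same shape as the tree's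
`WeierstrassCurve.SelmerDualData.isDualPair` for the classical Selmer group.
[cite: GreenbergLNM1716, §1 p. 60 (after Conj. 1.3)] [cite: Castella2018, §2.2 (arXiv:1704.06608 p. 5), "`1 + T ↦ γ`"] -/
theorem isDualPair :
    IwasawaDual.IsDualPair p (conjSelmerAc W p κ 𝔭 S γ - 1)
      (AddMonoidHom.id (XAc W p κ 𝔭 S γ)) where
  bijective := Function.bijective_id
  T_smul x s := by
    show ((PowerSeries.X : IwasawaAlgebra p) • x) s = x ((conjSelmerAc W p κ 𝔭 S γ - 1) s)
    rw [X_smul_apply, IwasawaDual.End_sub_apply, AddMonoid.End.one_apply, map_sub]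
  C_smul c x s k hk := by
    show ((PowerSeries.C c : IwasawaAlgebra p) • x) s = (PadicInt.toZModPow k c).val • x s
    exact C_smul_apply W p κ 𝔭 S γ c x hk
  locNil := isLocNil_conjSelmerAc_sub_one W p κ 𝔭 S hγ.out

/-- **Nakayama for `X_ac^Σ(E[p^∞])`**: if `Sel_𝔭^Σ(K_∞, E[p^∞])[𝔪] = {s | p s = 0, conj_γ s = s}`
(`𝔪 = (p, T)`, the Pontryagin dual of `X_ac^Σ/𝔪 X_ac^Σ`) is finite, then `X_ac^Σ(E[p^∞])` is a
finitely generated `Λ = ℤ_p⟦T⟧`-module — the tree's PROVED Nakayama lemma for dual pairs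
(`IwasawaDual.IsDualPair.module_finite`, Lang Ch. 5 §1) applied to `isDualPair`. This is the
reduction of Castella's "easily shown to be a finitely generated `Λ`-module" (Cas18 §2.1) to the
finiteness of `Sel[𝔪]`, which `AnticyclotomicModuleFinite.lean` proves for finite `Σ`.
[cite: Castella2018, §2.1 (arXiv:1704.06608 p. 5), "easily shown to be a finitely generated `Λ`-module"] [cite: GreenbergLNM1716, §1 p. 60 (after Conj. 1.3)] -/
theorem module_finite_of_finite
    (hfin : Set.Finite {s : selmerAc W p κ 𝔭 S |
      p • s = 0 ∧ W.conjH1 p κ.kerSubgroup γ (s : W.subgroupH1 p κ.kerSubgroup) = s}) :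
    Module.Finite (IwasawaAlgebra p) (XAc W p κ 𝔭 S γ) := by
  refine (isDualPair W p κ 𝔭 S γ).module_finite ?_
  refine hfin.subset fun s hs ↦ ?_
  obtain ⟨hs1, hs2⟩ := hs
  rw [pow_one] at hs1 hs2
  refine ⟨hs1, ?_⟩
  rw [IwasawaDual.End_sub_apply, AddMonoid.End.one_apply, sub_eq_zero] at hs2
  have h := congrArg (fun z : selmerAc W p κ 𝔭 S ↦ (z : W.subgroupH1 p κ.kerSubgroup)) hs2
  simpa only [coe_conjSelmerAc_apply] using h

/-- **`#(X_ac^Σ / T X_ac^Σ) = #(Sel_𝔭^Σ)^{γ}`** (`X/TX ≅ Hom(S^Γ, ℚ/ℤ)`; `Nat.card`, so `0 = 0` when both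
are infinite). [cite: GreenbergLNM1716, §1 p. 60] -/
theorem natCard_coinvariants_eq :
    Nat.card (IwasawaAlgebra.coinvariants p (XAc W p κ 𝔭 S γ)) =
      Nat.card (IwasawaDual.endInvariants (conjSelmerAc W p κ 𝔭 S γ - 1)) :=
  (isDualPair W p κ 𝔭 S γ).natCard_coinvariants

/-- **`#X_ac^Σ[T] = #(Sel_𝔭^Σ)_{γ}`** (`X[T] ≅ Hom(S_Γ, ℚ/ℤ)`). [cite: GreenbergLNM1716, §1 p. 60] -/
theorem natCard_invariants_eq :
    Nat.card (IwasawaAlgebra.invariants p (XAc W p κ 𝔭 S γ)) =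
      Nat.card (IwasawaDual.EndCoinvariants (conjSelmerAc W p κ 𝔭 S γ - 1)) :=
  (isDualPair W p κ 𝔭 S γ).natCard_invariants

/-- `X_ac^Σ / T X_ac^Σ` is finite iff `(Sel_𝔭^Σ)^{γ}` is. [cite: GreenbergLNM1716, §1 p. 60] -/
theorem finite_coinvariants_iff :
    Finite (IwasawaAlgebra.coinvariants p (XAc W p κ 𝔭 S γ)) ↔
      Finite (IwasawaDual.endInvariants (conjSelmerAc W p κ 𝔭 S γ - 1)) :=
  (isDualPair W p κ 𝔭 S γ).finite_coinvariants_iff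

/-- `X_ac^Σ[T]` is finite iff `(Sel_𝔭^Σ)_{γ}` is. [cite: GreenbergLNM1716, §1 p. 60] -/
theorem finite_invariants_iff :
    Finite (IwasawaAlgebra.invariants p (XAc W p κ 𝔭 S γ)) ↔
      Finite (IwasawaDual.EndCoinvariants (conjSelmerAc W p κ 𝔭 S γ - 1)) :=
  (isDualPair W p κ 𝔭 S γ).finite_invariants_iff

/-- **Greenberg's Lemma 4.2 for `X_ac^Σ(E[p^∞])`.** If `X_ac^Σ` is finitely generated and
`Λ`-torsion, `Ch_Λ(X_ac^Σ) = (f)`, and `Sel^γ := {s ∈ Sel_𝔭^Σ(K_∞, E[p^∞]) | conj_γ s = s}` is finite, then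
`Sel_γ := Sel/(conj_γ − 1)Sel` is finite, `T ∤ f`, `f(0) ≠ 0`, and `f(0) · #Sel_γ = u · #Sel^γ` for some
`u ∈ ℤ_pˣ` ("`f(0) ∼ |S^Γ|/|S_Γ|`"). The tree's `IwasawaDual.IsDualPair` form of LNM 1716 Lemma 4.2
applied to `isDualPair`. Consequently `ord_p f(0) = log_p #Sel^γ − log_p #Sel_γ` depends only on the
subgroups `Sel^γ` and `(conj_γ − 1) Sel`.
[cite: GreenbergLNM1716, §4 Lemma 4.2 (p. 102)] [cite: Castella2018, Thm. 2.3 (arXiv:1704.06608 p. 5), "`#ℤ_p/f_ac^Σ(0)`"] -/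
theorem eulerChar [Module.Finite (IwasawaAlgebra p) (XAc W p κ 𝔭 S γ)]
    (hX : Module.IsTorsion (IwasawaAlgebra p) (XAc W p κ 𝔭 S γ)) (f : IwasawaAlgebra p)
    (hf : XAc.charIdeal W p κ 𝔭 S γ = Ideal.span {f})
    (hfin : Finite (IwasawaDual.endInvariants (conjSelmerAc W p κ 𝔭 S γ - 1))) :
    Finite (IwasawaDual.EndCoinvariants (conjSelmerAc W p κ 𝔭 S γ - 1)) ∧ f.order = 0 ∧
      PowerSeries.constantCoeff f ≠ 0 ∧
      ∃ u : ℤ_[p]ˣ, PowerSeries.constantCoeff f *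
          (Nat.card (IwasawaDual.EndCoinvariants (conjSelmerAc W p κ 𝔭 S γ - 1)) : ℤ_[p]) =
        u * Nat.card (IwasawaDual.endInvariants (conjSelmerAc W p κ 𝔭 S γ - 1)) :=
  ⟨(isDualPair W p κ 𝔭 S γ).finite_endCoinvariants_of_finite hX hfin,
    ((isDualPair W p κ 𝔭 S γ).order_charGenerator_eq_zero_of_finite_endInvariants hX f hf hfin).1,
    ((isDualPair W p κ 𝔭 S γ).order_charGenerator_eq_zero_of_finite_endInvariants hX f hf hfin).2,
    (isDualPair W p κ 𝔭 S γ).constantCoeff_charGenerator_mul_natCard_endCoinvariants hX f hf hfin⟩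

end XAc

end Summit.BirchSwinnertonDyer.Rank1Residual.X11b.AcSelmer

end
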